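import Literature.Geometry.Kaehler.ComplexTorusSurfaceEllipticCurves
import Literature.Geometry.Kaehler.ComplexTorusSubtorusQuotientCohomology
import Literature.Geometry.Kaehler.ComplexTorusSubtorusNonTransverseProduct
import HarnessLib

/-!
# The class of an abelian divisor is primitive, and determines the divisor
# (Auffarth 2015, Thm. 1.1 / Lemma 2.7 / Cor. 2.6; Kani 1994 for surfaces — at torus level)

Layer `Literature/Geometry/Kaehler`, namespace `Literature.Geometry.Kaehler.ComplexTorus`; lane `lit-hodgefound`
(Track 2 foundations library, Layer A4), row **A4-61** (seat skel-4). Sequel of row A4-60 FILE 1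
(`ComplexTorusSurfaceEllipticCurves`: a complex `2`-torus contains an elliptic curve iff `NS(X)` has a non-zero
class of self-intersection `0`) and of rows A4-18 / p36 (`ComplexTorusSubtorusFrameOfSubspace`: the cycle class
`[Y] = p^*vol_{X/Y}` of the subtorus `Y = Φ(W)/(Φ(W) ∩ Λ)` of a complex lattice subspace `W`).

## Source, VERBATIM

R. Auffarth, *Elliptic curves on abelian varieties*, Illinois J. Math. **59** (2015), no. 2
[Auffarth2015EllipticCurvesAbelianVarieties; open copy `paper:arxiv-1507.08617`], §1 (p0003) and §2 (p0005–p0006):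

> An abelian divisor will be an abelian subvariety of `A` of codimension 1, seen as a prime (Weil) divisor on `A`.
> […] If `G` is a free abelian group, then we will say that `g ∈ G` is a primitive element of `G` if `G/⟨g⟩` is
> torsion-free.
> **Theorem 1.1.** Let `A` be an abelian variety of dimension `n`, and let `Θ` be a fixed ample divisor on `A`. Then
> the map `Z ↦ [Z]` induces a bijective correspondence between abelian divisors on `A` and primitive elements
> `α ∈ NS(A)` that satisfy `α² = 0` in `𝔄^*(A)` and `(α · Θ^{n−1}) > 0`. In particular, `A` contains an elliptic
> curve if and only if there exists a non-zero class `α ∈ NS(A)` that satisfies `α² = 0`.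
> **Corollary 2.6.** If `α ∈ NS(A)`, then `α = m[Z]` for some abelian divisor `Z` and some `m ∈ ℤ` if and only if
> `α² = 0` in `𝔄^*(A)`.
> **Lemma 2.7.** The class of an abelian divisor is primitive.
> **Definition 2.3.** We will say that a class `α ∈ NS(A)` is primitive if every time we have `α = mβ` for some
> `β ∈ NS(A)`, then `m = ±1`.

For surfaces this is E. Kani, *Elliptic curves on abelian surfaces*, Manuscripta Math. **84** (1994) 199–223
[Kani1994EllipticCurvesAbelianSurfaces] ("Kani [Kani] described all abelian surfaces that contain an elliptic curve
by means of intersection theory, and in this paper we generalize his methods to arbitrary dimension", p0003), whose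
text is not held (WANTED acq-10154); the statements below are formalized from Auffarth's paper and cite both.

## Torus-level reading and the proof formalized

`X = E/Φ(ℤ^ι)` a complex torus of dimension `g` (`|ι| = 2g = m + 2`); an ABELIAN DIVISOR is the codimension-one
complex subtorus `Y = Φ(W)/(Φ(W) ∩ Λ)` of a complex lattice subspace `W ⊆ Λ ⊗ ℝ` of rank `m = 2g − 2`
(`IsLatticeSubspace`, `IsComplexSubspace`, `subRank W = m`); its class is the integral `(1,1)`-form
`[Y] = (SubtorusFrame.ofSubspace Φ W …).cycleForm e ∈ H²(X, ℤ) ∩ H^{1,1}` of rows A4-18 / p36 (positively oriented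
adapted frame; `cycleForm_mem_integralForms`, `cycleForm_mem_hodgeClasses`), which p36 computes as the pull-back
`[Y] = p^*vol_{X/Y}` of the volume form of the ONE-dimensional quotient torus `X/Y` along `p : E → E/Φ(W)_ℂ`
(`SubtorusFrame.cycleForm_ofSubspace`). "`α² = 0`" is read in `H⁴(X)`: `α ∧ α = 0` (for `g = 2` equivalently
"`α` is degenerate", row A4-60 `degenerate_iff_wedge_self_eq_zero`); "primitive" is Definition 2.3 inside
`H²(X, ℤ) = integralForms Φ 2`: `k • β = α` with `β` integral forces `k = ±1`. Everything below is linear algebra of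
the rank-`2` form `p^*vol_{X/Y}` — a shorter road than the printed route through Nakai–Moishezon / `K(D)`
(Prop. 2.5, Remark 2.8), available because the tree already has `[Y] = p^*vol_{X/Y}`:

* §1 `T_Y ⊆ rad [Y]` (`cycleForm_ofSubspace_apply_eq_zero_of_mem`, any codimension) and the value
  `[Y](λ_{s₀}, λ_{s₁}) = ±1` on the two adapted lattice vectors complementary to `Λ ∩ W`
  (`cycleForm_ofSubspace_apply_adaptedBasis`; they map to the lattice basis of `X/Y`, on which `vol_{X/Y} = ±1`),
  whence **Lemma 2.7: `[Y]` is primitive in `H²(X, ℤ)`** (`cycleForm_ofSubspace_primitive`, any codimension) and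
  `[Y] ≠ 0`.
* §2 (codimension one) **`rad [Y] = T_Y`** (`forall_cycleForm_ofSubspace_apply_eq_zero_iff`: `vol_{X/Y}` is a
  non-degenerate `2`-form on the real plane `E/Φ(W)`), so **`Y ↦ [Y]` is injective** (`eq_of_cycleForm_ofSubspace_eq`:
  `W` is recovered from `[Y]`).
* §3 (codimension one) **every `2`-form `θ` with `T_Y ⊆ rad θ` is a multiple of `[Y]`**:
  `θ = (± θ(λ_{s₀}, λ_{s₁})) • [Y]` (`eq_smul_cycleForm_ofSubspace`; two alternating forms on `E` vanishing on
  `Φ(W)` of codimension `2` are proportional), hence **Corollary 2.6 at torus level**: an `E ∈ NS(X)` whose radical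
  contains `T_Y` is an INTEGER multiple `c[Y]`, `c = ±E(λ_{s₀}, λ_{s₁}) ∈ ℤ` (`exists_int_smul_cycleForm_of_integral`),
  `c ≠ 0` iff `E ≠ 0`, and `c = ±1` if `E` is primitive (`eq_or_eq_neg_cycleForm_of_primitive`).
* §4 (`g = 2`, with row A4-60) **Theorem 1.1 for abelian surfaces / Kani**: the classes `γ ∈ H²(X, ℤ) ∩ H^{1,1}`
  which are primitive with `γ ∧ γ = 0` are exactly the classes `±[Y]` of the elliptic curves `Y ⊂ X`
  (`exists_cycleForm_of_primitive_of_wedge_self_eq_zero` with §1), and `Y` is determined by `[Y]` (§2). The sign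
  `(α · Θ) > 0` singles out `[Y]` among `±[Y]` on an abelian surface; at torus level (no polarization assumed) the
  statement is up to sign — Scope.

## Contents (theorems only; no definition, no named fact)

* §0 (private) the proportionality of two `2`-forms with a common radical of codimension `2`.
* §1 `card_quotIndex_eq`, **`cycleForm_ofSubspace_apply_eq_zero_of_mem`**, `quotientTorusMatrix_mulVec_intVec_adaptedBasis`,
  `realRep_quotient_latticeVec_adaptedBasis`, **`cycleForm_ofSubspace_apply_adaptedBasis`** (`= ±1`),
  `cycleForm_ofSubspace_apply_adaptedBasis_eq_or`, **`cycleForm_ofSubspace_primitive`** (Lemma 2.7),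
  `cycleForm_ofSubspace_ne_zero`.
* §2 `exists_mem_add_combo`, **`forall_cycleForm_ofSubspace_apply_eq_zero_iff`** (`rad [Y] = T_Y`),
  **`eq_of_cycleForm_ofSubspace_eq`** (injectivity of `Y ↦ [Y]`).
* §3 **`eq_smul_cycleForm_ofSubspace`**, **`exists_int_smul_cycleForm_of_integral`** (Cor. 2.6),
  **`eq_or_eq_neg_cycleForm_of_primitive`**.
* §4 (`g = 2`) **`exists_cycleForm_of_primitive_of_wedge_self_eq_zero`** (Thm. 1.1 / Kani, surjectivity up to sign),
  **`cycleForm_ofSubspace_mem_and_primitive_and_wedge_self`** (the class of an elliptic curve is a non-zero primitive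
  integral Hodge class of square zero).

## Scope (not formalized here)

The degree condition `(α · Θ^{n−1}) > 0` / positivity `∫_Y Θ > 0` (orientation conventions of `∫_X` against the
tree's `c₁ = −E`); Theorem 1.2 (the forms `q_r` on `NS(A, Θ)`); for `g ≥ 3` the converse "`α ∧ α = 0 ⟹ rank α ≤ 2`"
(Plücker) is not needed for §1–§3 and not supplied (§4 is `g = 2`, where it is row A4-60's Pfaffian criterion).

## References

* [Auffarth2015EllipticCurvesAbelianVarieties] R. Auffarth, *Elliptic curves on abelian varieties*, Illinois J.
  Math. 59 (2015), no. 2, 271–279; arXiv:1507.08617 — Thm. 1.1 (§1), Def. 2.3, Cor. 2.6, Lemma 2.7, Thm. 2.10 (§2).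
* [Kani1994EllipticCurvesAbelianSurfaces] E. Kani, *Elliptic curves on abelian surfaces*, Manuscripta Math. 84
  (1994), 199–223, doi:10.1007/bf02567454 (the case `n = 2`; not held).
* [Lange2023AbelianVarietiesComplex] H. Lange, *Abelian Varieties over the Complex Numbers*, Springer (2023),
  §1.5.4 (1.22) (radical torus), §5.1.5 Exercise (17), §6.2.1 (cycle classes).
* [VoisinHodgeI2002] C. Voisin, *Hodge Theory and Complex Algebraic Geometry I*, CUP (2002), §11.1.2 Cor. 11.15.
-/

noncomputable section

-- Typeclass synthesis inside unification on `E [⋀^Fin k]→L[ℝ] ℂ` (its `ℂ`-module structure) nests deeper than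
-- the default pending depth (as in row A4-13's `ComplexTorusNeronSeveriPeriodMatrix`).
set_option maxSynthPendingDepth 3

open Module Function Complex Matrix

namespace Literature.Geometry.Kaehler

namespace ComplexTorus

/-! ## §0 Two-forms: bilinearity bookkeeping and the proportionality principle -/

section TwoForms

variable {E : Type*} [NormedAddCommGroup E] [NormedSpace ℂ E]

/-- Additivity in the first slot (`ℂ`-valued `2`-forms). [folklore] -/
private theorem twoFormC_add_left (θ : E [⋀^Fin 2]→L[ℝ] ℂ) (x x' y : E) :
    θ ![x + x', y] = θ ![x, y] + θ ![x', y] :=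
  θ.vecCons_add ![y] x x'

/-- Homogeneity in the first slot (`ℂ`-valued `2`-forms). [folklore] -/
private theorem twoFormC_smul_left (θ : E [⋀^Fin 2]→L[ℝ] ℂ) (r : ℝ) (x y : E) :
    θ ![r • x, y] = r • θ ![x, y] :=
  θ.vecCons_smul ![y] r x

/-- Antisymmetry (`ℂ`-valued `2`-forms). [folklore] -/
private theorem twoFormC_swap (θ : E [⋀^Fin 2]→L[ℝ] ℂ) (x y : E) : θ ![x, y] = -θ ![y, x] := by
  have h := θ.toAlternatingMap.map_swap ![y, x] (show (0 : Fin 2) ≠ 1 by decide)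
  have e : (![y, x] ∘ Equiv.swap (0 : Fin 2) 1) = ![x, y] := by
    funext i; fin_cases i <;> rfl
  rw [e] at h
  exact h

/-- Additivity in the second slot (`ℂ`-valued `2`-forms). [folklore] -/
private theorem twoFormC_add_right (θ : E [⋀^Fin 2]→L[ℝ] ℂ) (x y y' : E) :
    θ ![x, y + y'] = θ ![x, y] + θ ![x, y'] := by
  rw [twoFormC_swap θ x, twoFormC_add_left, neg_add, ← twoFormC_swap, ← twoFormC_swap]

/-- Homogeneity in the second slot (`ℂ`-valued `2`-forms). [folklore] -/
private theorem twoFormC_smul_right (θ : E [⋀^Fin 2]→L[ℝ] ℂ) (r : ℝ) (x y : E) :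
    θ ![x, r • y] = r • θ ![x, y] := by
  rw [twoFormC_swap θ x, twoFormC_smul_left, ← smul_neg, ← twoFormC_swap]

/-- `θ(x, x) = 0`. [folklore] -/
private theorem twoFormC_self (θ : E [⋀^Fin 2]→L[ℝ] ℂ) (x : E) : θ ![x, x] = 0 :=
  θ.map_eq_zero_of_eq ![x, x] (i := 0) (j := 1) rfl (by decide)

/-- Expansion of a `2`-form on combinations of two vectors modulo its radical:
`θ(w + a s₀ + b s₁, w' + a' s₀ + b' s₁) = (ab' − ba') θ(s₀, s₁)` when `θ(w, ·) = θ(w', ·) = 0`. [folklore] -/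
private theorem twoFormC_apply_combo (θ : E [⋀^Fin 2]→L[ℝ] ℂ) {w w' : E} (hw : ∀ v, θ ![w, v] = 0)
    (hw' : ∀ v, θ ![w', v] = 0) (s₀ s₁ : E) (a b a' b' : ℝ) :
    θ ![w + a • s₀ + b • s₁, w' + a' • s₀ + b' • s₁] = (a * b' - b * a') • θ ![s₀, s₁] := by
  have hw'' : ∀ v, θ ![v, w'] = 0 := fun v ↦ by rw [twoFormC_swap, hw', neg_zero]
  have hswap : θ ![s₁, s₀] = -θ ![s₀, s₁] := twoFormC_swap θ s₁ s₀
  simp only [twoFormC_add_left, twoFormC_add_right, twoFormC_smul_left, twoFormC_smul_right, hw, hw'',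
    twoFormC_self, hswap, smul_zero, zero_add, add_zero, Complex.real_smul, smul_neg]
  push_cast
  ring

/-- **Proportionality principle.** Two `2`-forms `θ₁, θ₂` on `E` whose radicals contain a subspace `T` of
codimension `≤ 2` (every vector is `w + a s₀ + b s₁` with `w ∈ T`) satisfy `θ₁(s₀, s₁) θ₂ = θ₂(s₀, s₁) θ₁`
(both are multiples of the determinant on `E/T`; private linear-algebra helper). [folklore] -/
private theorem smul_eq_smul_of_forall_apply_eq_zero (θ₁ θ₂ : E [⋀^Fin 2]→L[ℝ] ℂ) (T : Set E) (s₀ s₁ : E)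
    (hspan : ∀ u : E, ∃ w ∈ T, ∃ a b : ℝ, u = w + a • s₀ + b • s₁)
    (h₁ : ∀ w ∈ T, ∀ v, θ₁ ![w, v] = 0) (h₂ : ∀ w ∈ T, ∀ v, θ₂ ![w, v] = 0) :
    θ₁ ![s₀, s₁] • θ₂ = θ₂ ![s₀, s₁] • θ₁ := by
  ext v
  have hv : v = ![v 0, v 1] := by
    funext i; fin_cases i <;> rfl
  obtain ⟨w, hw, a, b, h0⟩ := hspan (v 0)
  obtain ⟨w', hw', a', b', h1⟩ := hspan (v 1)
  rw [ContinuousAlternatingMap.smul_apply, ContinuousAlternatingMap.smul_apply, hv, h0, h1,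
    twoFormC_apply_combo θ₁ (h₁ w hw) (h₁ w' hw'), twoFormC_apply_combo θ₂ (h₂ w hw) (h₂ w' hw'),
    smul_eq_mul, smul_eq_mul, Complex.real_smul, Complex.real_smul]
  ring

end TwoForms

/-! ## §1 `T_Y ⊆ rad [Y]`, `[Y](λ_{s₀}, λ_{s₁}) = ±1`, `[Y]` is primitive (any codimension) -/

section AnyCodimension

variable {ι : Type*} [Fintype ι] [DecidableEq ι] {E : Type*} [NormedAddCommGroup E] [NormedSpace ℂ E]
  (Φ : (ι → ℝ) ≃L[ℝ] E) (W : Submodule ℝ (ι → ℝ)) (hW : IsLatticeSubspace W) (hWc : IsComplexSubspace Φ W)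
  {m l : ℕ} (eY : Fin m ≃ Fin (subRank W)) (hpos : orientationSign (subtorusPeriod Φ W hW hWc) eY = 1)
  (e : Fin (m + l) ≃ ι) (e'' : Fin l ≃ QuotIndex W)

omit [DecidableEq ι] in
include eY e in
/-- `|QuotIndex W| = l` when `|ι| = m + l` and `rk(Λ ∩ W) = m` (so the quotient index can be enumerated by `Fin l`).
[cite: Lange2023AbelianVarietiesComplex, §1.4.1 Prop. 1.4.2, p. 43] -/
theorem card_quotIndex_eq : Fintype.card (QuotIndex W) = l := by
  have h1 := card_eq_subRank_add_card_quotIndex W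
  have h2 : Fintype.card ι = m + l := by rw [← Fintype.card_congr e, Fintype.card_fin]
  have h3 : m = subRank W := by simpa using Fintype.card_congr eY
  omega

/-- **`T_Y ⊆ rad [Y]`**: the class of the subtorus `Y` vanishes as soon as one argument is tangent to `Y`
(`[Y] = p^*vol_{X/Y}` and `p(T_Y) = 0`). [cite: Auffarth2015EllipticCurvesAbelianVarieties, §2 Prop. 2.1 (`[Z]² = 0`: `Z ∩ (Z + x) = ∅`)] [cite: VoisinHodgeI2002, §11.1.2 Cor. 11.15] -/
theorem cycleForm_ofSubspace_apply_eq_zero_of_mem (v : Fin l → E) {i : Fin l} {w : ι → ℝ} (hw : w ∈ W)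
    (hvi : v i = Φ w) : (SubtorusFrame.ofSubspace Φ W hW hWc eY hpos).cycleForm e v = 0 := by
  classical
  obtain ⟨e''⟩ : Nonempty (Fin l ≃ QuotIndex W) := ⟨(Fintype.equivFinOfCardEq (card_quotIndex_eq W eY e)).symm⟩
  rw [SubtorusFrame.cycleForm_ofSubspace Φ W hW hWc eY hpos e e'',
    ContinuousAlternatingMap.compContinuousLinearMap_apply]
  refine (volumeForm _ e'').map_coord_zero i ?_
  rw [Function.comp_apply, hvi, realRep_apply, quotientTorusMatrix_mulVec_eq_zero_of_mem hW hw, map_zero]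

omit [DecidableEq ι] in
/-- The columns of the section matrix are the complementary adapted lattice vectors, and `Q` maps them to the unit
vectors: `Q_ℝ λ_{s_k} = e_k` (`Q V = 1`). [cite: Lange2023AbelianVarietiesComplex, §1.4.1 Prop. 1.4.2 (proof), p. 43] -/
theorem quotientTorusMatrix_mulVec_intVec_adaptedBasis (k : QuotIndex W) :
    (quotientTorusMatrix W).map (Int.cast : ℤ → ℝ) *ᵥ intVec (adaptedBasis W k.1) = Pi.single k 1 := by
  have hcol : intVec (adaptedBasis W k.1) = (sectionMatrix W).map (Int.cast : ℤ → ℝ) *ᵥ Pi.single k 1 := by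
    rw [Matrix.mulVec_single_one]
    rfl
  rw [hcol, Matrix.mulVec_mulVec, quotientTorusMatrix_mul_sectionMatrix_real, Matrix.one_mulVec]

omit [DecidableEq ι] in
/-- `p(λ_{s_k}) = λ''_k`: the complementary adapted lattice vectors map to the lattice basis of `X/Y`.
[cite: Lange2023AbelianVarietiesComplex, §1.5.4 (the quotient complex torus), p. 58] -/
theorem realRep_quotient_latticeVec_adaptedBasis (k : QuotIndex W) :
    realRep Φ (quotientTorusPeriod Φ W hW hWc) (quotientTorusMatrix W) (latticeVec Φ (adaptedBasis W k.1)) =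
      quotientTorusPeriod Φ W hW hWc (Pi.single k 1) := by
  rw [show latticeVec Φ (adaptedBasis W k.1) = Φ (intVec (adaptedBasis W k.1)) from rfl, realRep_apply,
    quotientTorusMatrix_mulVec_intVec_adaptedBasis]

/-- **`[Y](λ_{s₀}, …, λ_{s_{l−1}}) = ±1`**: on the complementary adapted lattice vectors (a `ℤ`-basis of
`Λ/(Λ ∩ W)`, the lattice of `X/Y`) the class of `Y` takes the value `vol_{X/Y}(λ''₀, …) = sign = ±1`.
[cite: Auffarth2015EllipticCurvesAbelianVarieties, §2 Lemma 2.7] [cite: Lange2023AbelianVarietiesComplex, §6.2.4 (p. 310: the cup product is unimodular)] -/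
theorem cycleForm_ofSubspace_apply_adaptedBasis :
    (SubtorusFrame.ofSubspace Φ W hW hWc eY hpos).cycleForm e
        (fun j ↦ latticeVec Φ (adaptedBasis W (e'' j).1)) =
      (orientationSign (quotientTorusPeriod Φ W hW hWc) e'' : ℂ) := by
  rw [SubtorusFrame.cycleForm_ofSubspace Φ W hW hWc eY hpos e e'',
    ContinuousAlternatingMap.compContinuousLinearMap_apply, ← volumeForm_apply_latticeFrame]
  congr 1
  funext j
  rw [Function.comp_apply, realRep_quotient_latticeVec_adaptedBasis, latticeFrame_apply]

/-- `[Y](λ_{s₀}, …) = ±1` as a disjunction. [cite: Auffarth2015EllipticCurvesAbelianVarieties, §2 Lemma 2.7] -/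
theorem cycleForm_ofSubspace_apply_adaptedBasis_eq_or :
    (SubtorusFrame.ofSubspace Φ W hW hWc eY hpos).cycleForm e (fun j ↦ latticeVec Φ (adaptedBasis W (e'' j).1)) = 1 ∨
      (SubtorusFrame.ofSubspace Φ W hW hWc eY hpos).cycleForm e
          (fun j ↦ latticeVec Φ (adaptedBasis W (e'' j).1)) = -1 := by
  rw [cycleForm_ofSubspace_apply_adaptedBasis Φ W hW hWc eY hpos e e'']
  rcases orientationSign_eq_or (quotientTorusPeriod Φ W hW hWc) e'' with h | h <;> simp [h]

/-- **Lemma 2.7 at torus level: the class `[Y] ∈ H^l(X, ℤ)` of a complex subtorus is PRIMITIVE** — if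
`[Y] = k β` with `β` integral and `k ∈ ℤ` then `k = ±1` (evaluate on the complementary adapted lattice vectors:
`k · β(λ_s) = ±1` with `β(λ_s) ∈ ℤ`). [cite: Auffarth2015EllipticCurvesAbelianVarieties, §2 Lemma 2.7 and Def. 2.3] [cite: Kani1994EllipticCurvesAbelianSurfaces, (surfaces)] -/
theorem cycleForm_ofSubspace_primitive (k : ℤ) {β : E [⋀^Fin l]→L[ℝ] ℂ} (hβ : β ∈ integralForms Φ l)
    (h : (k : ℂ) • β = (SubtorusFrame.ofSubspace Φ W hW hWc eY hpos).cycleForm e) : k = 1 ∨ k = -1 := by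
  classical
  set e'' : Fin l ≃ QuotIndex W := (Fintype.equivFinOfCardEq (card_quotIndex_eq W eY e)).symm
  obtain ⟨z, hz⟩ := hβ (fun j ↦ adaptedBasis W (e'' j).1)
  have hval := congrArg (fun θ : E [⋀^Fin l]→L[ℝ] ℂ ↦ θ (fun j ↦ latticeVec Φ (adaptedBasis W (e'' j).1))) h
  simp only [ContinuousAlternatingMap.smul_apply, smul_eq_mul] at hval
  have hz' : β (fun j ↦ latticeVec Φ (adaptedBasis W (e'' j).1)) = (z : ℂ) := by
    rw [← hz]; rfl
  rw [hz', cycleForm_ofSubspace_apply_adaptedBasis Φ W hW hWc eY hpos e e''] at hval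
  have hkz : k * z = orientationSign (quotientTorusPeriod Φ W hW hWc) e'' := by exact_mod_cast hval
  rcases orientationSign_eq_or (quotientTorusPeriod Φ W hW hWc) e'' with hs | hs <;> rw [hs] at hkz
  · exact Int.eq_one_or_neg_one_of_mul_eq_one hkz
  · have : k * (-z) = 1 := by rw [mul_neg, hkz, neg_neg]
    exact Int.eq_one_or_neg_one_of_mul_eq_one this

/-- **`[Y] ≠ 0`.** [cite: Auffarth2015EllipticCurvesAbelianVarieties, §2 Lemma 2.7] -/
theorem cycleForm_ofSubspace_ne_zero : (SubtorusFrame.ofSubspace Φ W hW hWc eY hpos).cycleForm e ≠ 0 := by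
  classical
  set e'' : Fin l ≃ QuotIndex W := (Fintype.equivFinOfCardEq (card_quotIndex_eq W eY e)).symm
  intro h
  have hval := cycleForm_ofSubspace_apply_adaptedBasis Φ W hW hWc eY hpos e e''
  rw [h, ContinuousAlternatingMap.coe_zero, Pi.zero_apply] at hval
  rcases orientationSign_eq_or (quotientTorusPeriod Φ W hW hWc) e'' with hs | hs <;> rw [hs] at hval <;>
    norm_num at hval

end AnyCodimension

/-! ## §2 Codimension one: `rad [Y] = T_Y`, so `Y ↦ [Y]` is injective -/

section CodimensionOne

variable {ι : Type*} [Fintype ι] [DecidableEq ι] {E : Type*} [NormedAddCommGroup E] [NormedSpace ℂ E]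
  (Φ : (ι → ℝ) ≃L[ℝ] E) (W : Submodule ℝ (ι → ℝ)) (hW : IsLatticeSubspace W) (hWc : IsComplexSubspace Φ W)
  {m : ℕ} (eY : Fin m ≃ Fin (subRank W)) (hpos : orientationSign (subtorusPeriod Φ W hW hWc) eY = 1)
  (e : Fin (m + 2) ≃ ι) (e'' : Fin 2 ≃ QuotIndex W)

omit [DecidableEq ι] in
/-- Every index of the quotient is one of the two enumerated ones. [folklore] -/
private theorem quotIndex_eq_or (k : QuotIndex W) : k = e'' 0 ∨ k = e'' 1 := by
  rcases Fin.exists_fin_two.1 ⟨e''.symm k, rfl⟩ with h | h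
  · left; rw [← h, Equiv.apply_symm_apply]
  · right; rw [← h, Equiv.apply_symm_apply]

omit [DecidableEq ι] in
/-- A function on the two-element quotient index is a combination of the two unit vectors. [folklore] -/
private theorem eq_combo_single (y : QuotIndex W → ℝ) :
    y = y (e'' 0) • Pi.single (e'' 0) (1 : ℝ) + y (e'' 1) • Pi.single (e'' 1) (1 : ℝ) := by
  have hne : e'' 0 ≠ e'' 1 := fun h ↦ by simpa using e''.injective h
  funext k
  rcases quotIndex_eq_or W e'' k with rfl | rfl
  · simp [hne]
  · simp [hne.symm]

omit [DecidableEq ι] in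
/-- **Every vector is tangent to `Y` plus a combination of the two complementary adapted lattice vectors**
(`x = C R x + V Q x`, the lattice sequence of `Y ⊂ X ↠ X/Y` splits).
[cite: Lange2023AbelianVarietiesComplex, §1.4.1 Prop. 1.4.2 (proof), p. 43] -/
theorem exists_mem_add_combo (u : E) :
    ∃ w ∈ W, ∃ a b : ℝ, u = Φ w + a • latticeVec Φ (adaptedBasis W (e'' 0).1) + b • latticeVec Φ (adaptedBasis W (e'' 1).1) := by
  obtain ⟨x, rfl⟩ := Φ.surjective u
  set y := (quotientTorusMatrix W).map (Int.cast : ℤ → ℝ) *ᵥ x with hy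
  refine ⟨(subtorusMatrix W).map (Int.cast : ℤ → ℝ) *ᵥ ((retractionMatrix W).map (Int.cast : ℤ → ℝ) *ᵥ x),
    subtorusMatrix_mulVec_mem W _, y (e'' 0), y (e'' 1), ?_⟩
  have hsec : (sectionMatrix W).map (Int.cast : ℤ → ℝ) *ᵥ y =
      y (e'' 0) • intVec (adaptedBasis W (e'' 0).1) + y (e'' 1) • intVec (adaptedBasis W (e'' 1).1) := by
    conv_lhs => rw [eq_combo_single W e'' y]
    rw [Matrix.mulVec_add, Matrix.mulVec_smul, Matrix.mulVec_smul, Matrix.mulVec_single_one,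
      Matrix.mulVec_single_one]
    rfl
  conv_lhs => rw [← mulVec_decomposition W x]
  rw [map_add, hsec, map_add, map_smul, map_smul, add_assoc]
  rfl

/-- **`rad [Y] = T_Y` in codimension one**: `[Y](u, ·) = 0` iff `u` is tangent to `Y` — `vol_{X/Y}` is a
non-degenerate `2`-form on the real plane `E/Φ(W)`. Hence `Y` is recovered from its class.
[cite: Auffarth2015EllipticCurvesAbelianVarieties, §2 Thm. 2.10 (injectivity)] [cite: VoisinHodgeI2002, §11.1.2 Cor. 11.15] -/
theorem forall_cycleForm_ofSubspace_apply_eq_zero_iff (u : E) :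
    (∀ v, (SubtorusFrame.ofSubspace Φ W hW hWc eY hpos).cycleForm e ![u, v] = 0) ↔ Φ.symm u ∈ W := by
  classical
  obtain ⟨e''⟩ : Nonempty (Fin 2 ≃ QuotIndex W) := ⟨(Fintype.equivFinOfCardEq (card_quotIndex_eq W eY e)).symm⟩
  refine ⟨fun h ↦ ?_, fun hu v ↦ ?_⟩
  · by_contra hu
    obtain ⟨x, rfl⟩ := Φ.surjective u
    rw [ContinuousLinearEquiv.symm_apply_apply] at hu
    have ha0 : (quotientTorusMatrix W).map (Int.cast : ℤ → ℝ) *ᵥ x ≠ 0 := fun h0 ↦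
      hu ((mem_iff_quotientTorusMatrix_mulVec_eq_zero hW).2 h0)
    -- a unit vector `b` with `det(Q x, b) ≠ 0`
    obtain ⟨b, hb⟩ : ∃ b : QuotIndex W → ℝ,
        ((quotientTorusMatrix W).map (Int.cast : ℤ → ℝ) *ᵥ x) (e'' 0) * b (e'' 1) -
          b (e'' 0) * ((quotientTorusMatrix W).map (Int.cast : ℤ → ℝ) *ᵥ x) (e'' 1) ≠ 0 := by
      have hne : e'' 0 ≠ e'' 1 := fun h ↦ by simpa using e''.injective h
      by_cases h0 : ((quotientTorusMatrix W).map (Int.cast : ℤ → ℝ) *ᵥ x) (e'' 0) = 0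
      · have h1 : ((quotientTorusMatrix W).map (Int.cast : ℤ → ℝ) *ᵥ x) (e'' 1) ≠ 0 := by
          intro h1
          apply ha0
          funext k
          rcases quotIndex_eq_or W e'' k with rfl | rfl
          · exact h0
          · exact h1
        exact ⟨Pi.single (e'' 0) 1, by simp [hne.symm, h0, h1]⟩
      · exact ⟨Pi.single (e'' 1) 1, by simp [hne, h0]⟩
    -- the vector `v = Φ(V b)` maps to `Φ''(b)` in the quotient
    have hv := h (Φ ((sectionMatrix W).map (Int.cast : ℤ → ℝ) *ᵥ b))
    rw [SubtorusFrame.cycleForm_ofSubspace Φ W hW hWc eY hpos e e'',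
      ContinuousAlternatingMap.compContinuousLinearMap_apply, volumeForm_apply] at hv
    have hcomp : (⇑(realRep Φ (quotientTorusPeriod Φ W hW hWc) (quotientTorusMatrix W)) ∘
        ![Φ x, Φ ((sectionMatrix W).map (Int.cast : ℤ → ℝ) *ᵥ b)]) =
        ![quotientTorusPeriod Φ W hW hWc ((quotientTorusMatrix W).map (Int.cast : ℤ → ℝ) *ᵥ x),
          quotientTorusPeriod Φ W hW hWc b] := by
      funext j
      fin_cases j <;> simp [realRep_apply, Matrix.mulVec_mulVec, quotientTorusMatrix_mul_sectionMatrix_real]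
    rw [hcomp, Basis.det_apply, Matrix.det_fin_two] at hv
    simp only [Basis.toMatrix_apply, latticeBasis_repr, Matrix.cons_val_zero, Matrix.cons_val_one,
      ContinuousLinearEquiv.symm_apply_apply] at hv
    have hR : (orientationSign (quotientTorusPeriod Φ W hW hWc) e'' : ℝ) *
        (((quotientTorusMatrix W).map (Int.cast : ℤ → ℝ) *ᵥ x) (e'' 0) * b (e'' 1) -
          b (e'' 0) * ((quotientTorusMatrix W).map (Int.cast : ℤ → ℝ) *ᵥ x) (e'' 1)) = 0 := by
      exact_mod_cast hv
    rcases mul_eq_zero.1 hR with hs | hs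
    · rcases orientationSign_eq_or (quotientTorusPeriod Φ W hW hWc) e'' with h1 | h1 <;>
        rw [h1] at hs <;> norm_num at hs
    · exact hb hs
  · exact cycleForm_ofSubspace_apply_eq_zero_of_mem Φ W hW hWc eY hpos e _ (i := 0) hu (by simp)

variable {W' : Submodule ℝ (ι → ℝ)} (hW' : IsLatticeSubspace W') (hWc' : IsComplexSubspace Φ W')
  (eY' : Fin m ≃ Fin (subRank W')) (hpos' : orientationSign (subtorusPeriod Φ W' hW' hWc') eY' = 1)

/-- **`Y ↦ [Y]` is injective on abelian divisors**: two codimension-one complex subtori with the same class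
coincide. [cite: Auffarth2015EllipticCurvesAbelianVarieties, §2 Thm. 2.10 ("Injectivity was already proven")] -/
theorem eq_of_cycleForm_ofSubspace_eq
    (h : (SubtorusFrame.ofSubspace Φ W hW hWc eY hpos).cycleForm e =
      (SubtorusFrame.ofSubspace Φ W' hW' hWc' eY' hpos').cycleForm e) : W = W' := by
  ext x
  have h1 := forall_cycleForm_ofSubspace_apply_eq_zero_iff Φ W hW hWc eY hpos e (Φ x)
  have h2 := forall_cycleForm_ofSubspace_apply_eq_zero_iff Φ W' hW' hWc' eY' hpos' e (Φ x)
  rw [ContinuousLinearEquiv.symm_apply_apply] at h1 h2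
  rw [← h1, ← h2, h]

end CodimensionOne

/-! ## §3 Codimension one: every class with `T_Y` in its radical is an integer multiple of `[Y]` -/

section Multiples

variable {ι : Type*} [Fintype ι] [DecidableEq ι] {E : Type*} [NormedAddCommGroup E] [NormedSpace ℂ E]
  (Φ : (ι → ℝ) ≃L[ℝ] E) (W : Submodule ℝ (ι → ℝ)) (hW : IsLatticeSubspace W) (hWc : IsComplexSubspace Φ W)
  {m : ℕ} (eY : Fin m ≃ Fin (subRank W)) (hpos : orientationSign (subtorusPeriod Φ W hW hWc) eY = 1)
  (e : Fin (m + 2) ≃ ι) (e'' : Fin 2 ≃ QuotIndex W)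

/-- **A `2`-form vanishing on `T_Y` is a multiple of `[Y]`**: `θ = (sign · θ(λ_{s₀}, λ_{s₁})) • [Y]` for every
`θ ∈ Alt²_ℝ(E; ℂ)` with `Φ(W) ⊆ rad θ` (proportionality principle: `Φ(W)` has codimension `2`, and
`[Y](λ_{s₀}, λ_{s₁}) = sign = ±1`). [cite: Auffarth2015EllipticCurvesAbelianVarieties, §2 Cor. 2.6] -/
theorem eq_smul_cycleForm_ofSubspace (θ : E [⋀^Fin 2]→L[ℝ] ℂ) (hθ : ∀ w ∈ W, ∀ v, θ ![Φ w, v] = 0) :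
    θ = ((orientationSign (quotientTorusPeriod Φ W hW hWc) e'' : ℂ) *
        θ ![latticeVec Φ (adaptedBasis W (e'' 0).1), latticeVec Φ (adaptedBasis W (e'' 1).1)]) •
      (SubtorusFrame.ofSubspace Φ W hW hWc eY hpos).cycleForm e := by
  set Y := (SubtorusFrame.ofSubspace Φ W hW hWc eY hpos).cycleForm e with hY
  set s₀ := latticeVec Φ (adaptedBasis W (e'' 0).1) with hs₀
  set s₁ := latticeVec Φ (adaptedBasis W (e'' 1).1) with hs₁
  have key := smul_eq_smul_of_forall_apply_eq_zero Y θ (Φ '' (W : Set (ι → ℝ))) s₀ s₁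
    (fun u ↦ by
      obtain ⟨w, hw, a, b, hu⟩ := exists_mem_add_combo Φ W e'' u
      exact ⟨Φ w, ⟨w, hw, rfl⟩, a, b, hu⟩)
    (by
      rintro _ ⟨w, hw, rfl⟩ v
      exact cycleForm_ofSubspace_apply_eq_zero_of_mem Φ W hW hWc eY hpos e _ (i := 0) hw (by simp))
    (by
      rintro _ ⟨w, hw, rfl⟩ v
      exact hθ w hw v)
  have hval : Y ![s₀, s₁] = (orientationSign (quotientTorusPeriod Φ W hW hWc) e'' : ℂ) := by
    have h := cycleForm_ofSubspace_apply_adaptedBasis Φ W hW hWc eY hpos e e''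
    have hfun : (fun j : Fin 2 ↦ latticeVec Φ (adaptedBasis W (e'' j).1)) = ![s₀, s₁] := by
      funext j; fin_cases j <;> rfl
    rwa [hfun] at h
  rw [hval] at key
  have hsq : ((orientationSign (quotientTorusPeriod Φ W hW hWc) e'' : ℂ)) *
      (orientationSign (quotientTorusPeriod Φ W hW hWc) e'' : ℂ) = 1 := by
    exact_mod_cast orientationSign_mul_self (quotientTorusPeriod Φ W hW hWc) e''
  calc θ = ((orientationSign (quotientTorusPeriod Φ W hW hWc) e'' : ℂ) *
        (orientationSign (quotientTorusPeriod Φ W hW hWc) e'' : ℂ)) • θ := by rw [hsq, one_smul]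
    _ = (orientationSign (quotientTorusPeriod Φ W hW hWc) e'' : ℂ) •
        ((orientationSign (quotientTorusPeriod Φ W hW hWc) e'' : ℂ) • θ) := by rw [mul_smul]
    _ = _ := by rw [key, smul_smul]

/-- **Corollary 2.6 at torus level: an integral class with `T_Y` in its radical is an INTEGER multiple of `[Y]`**,
`E = c[Y]` with `c = ±E(λ_{s₀}, λ_{s₁}) ∈ ℤ`; `c ≠ 0` iff `E ≠ 0`.
[cite: Auffarth2015EllipticCurvesAbelianVarieties, §2 Cor. 2.6] [cite: Kani1994EllipticCurvesAbelianSurfaces, (surfaces)] -/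
theorem exists_int_smul_cycleForm_of_integral (θ : E [⋀^Fin 2]→L[ℝ] ℂ) (hθZ : θ ∈ integralForms Φ 2)
    (hθ : ∀ w ∈ W, ∀ v, θ ![Φ w, v] = 0) :
    ∃ c : ℤ, θ = (c : ℂ) • (SubtorusFrame.ofSubspace Φ W hW hWc eY hpos).cycleForm e ∧ (θ ≠ 0 ↔ c ≠ 0) := by
  classical
  set e'' : Fin 2 ≃ QuotIndex W := (Fintype.equivFinOfCardEq (card_quotIndex_eq W eY e)).symm
  obtain ⟨z, hz⟩ := hθZ ![adaptedBasis W (e'' 0).1, adaptedBasis W (e'' 1).1]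
  have hz' : θ ![latticeVec Φ (adaptedBasis W (e'' 0).1), latticeVec Φ (adaptedBasis W (e'' 1).1)] = (z : ℂ) := by
    rw [← hz]
    congr 1
    funext j; fin_cases j <;> rfl
  refine ⟨orientationSign (quotientTorusPeriod Φ W hW hWc) e'' * z, ?_, ?_⟩
  · have h := eq_smul_cycleForm_ofSubspace Φ W hW hWc eY hpos e e'' θ hθ
    rw [hz'] at h
    exact_mod_cast h
  · have h := eq_smul_cycleForm_ofSubspace Φ W hW hWc eY hpos e e'' θ hθ
    rw [hz'] at h
    constructor
    · intro hne hc
      apply hne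
      rw [h]
      have hc' : ((orientationSign (quotientTorusPeriod Φ W hW hWc) e'' : ℂ)) * (z : ℂ) = 0 := by
        exact_mod_cast hc
      rw [hc']
      simp
    · intro hc hθ0
      apply hc
      rw [hθ0, ContinuousAlternatingMap.coe_zero, Pi.zero_apply] at hz'
      have hz0 : z = 0 := by exact_mod_cast hz'.symm
      rw [hz0, mul_zero]

/-- **Uniqueness up to sign for primitive classes**: an integral `2`-class which is primitive (Def. 2.3 in
`H²(X, ℤ)`) and whose radical contains `T_Y` is `[Y]` or `−[Y]`.
[cite: Auffarth2015EllipticCurvesAbelianVarieties, §2 Cor. 2.9 / Thm. 2.10 (surjectivity)] [cite: Kani1994EllipticCurvesAbelianSurfaces, (surfaces)] -/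
theorem eq_or_eq_neg_cycleForm_of_primitive (θ : E [⋀^Fin 2]→L[ℝ] ℂ) (hθZ : θ ∈ integralForms Φ 2)
    (hprim : ∀ (k : ℤ) (β : E [⋀^Fin 2]→L[ℝ] ℂ), β ∈ integralForms Φ 2 → (k : ℂ) • β = θ → k = 1 ∨ k = -1)
    (hθ : ∀ w ∈ W, ∀ v, θ ![Φ w, v] = 0) :
    θ = (SubtorusFrame.ofSubspace Φ W hW hWc eY hpos).cycleForm e ∨
      θ = -(SubtorusFrame.ofSubspace Φ W hW hWc eY hpos).cycleForm e := by
  obtain ⟨c, hc, -⟩ := exists_int_smul_cycleForm_of_integral Φ W hW hWc eY hpos e θ hθZ hθ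
  rcases hprim c _ ((SubtorusFrame.ofSubspace Φ W hW hWc eY hpos).cycleForm_mem_integralForms e) hc.symm with
    h | h
  · left; rw [hc, h, Int.cast_one, one_smul]
  · right; rw [hc, h]; simp

end Multiples

/-! ## §4 Abelian surfaces (`g = 2`): Theorem 1.1 / Kani — primitive classes of square zero are `±[Y]` -/

section Surface

variable {ι : Type*} [Fintype ι] [DecidableEq ι] {E : Type*} [NormedAddCommGroup E] [NormedSpace ℂ E]
  (Φ : (ι → ℝ) ≃L[ℝ] E)

omit [Fintype ι] in
/-- The orientation sign is insensitive to a cast `Fin a = Fin b` of the enumeration (private copy of p36's).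
[folklore] -/
private theorem orientationSign_comp_cast₄ {κ F : Type*} [NormedAddCommGroup F] [NormedSpace ℂ F] [DecidableEq κ]
    (Ψ : (κ → ℝ) ≃L[ℝ] F) {a b : ℕ} (h : a = b) (f : Fin b → κ) :
    orientationSign Ψ (f ∘ Fin.cast h) = orientationSign Ψ f := by
  subst h; rfl

/-- **Theorem 1.1 for abelian surfaces at torus level (Kani): a primitive class `γ ∈ H²(X, ℤ) ∩ H^{1,1}(X)` with
`γ ∧ γ = 0` on a complex `2`-torus `X` is `±[Y]` for an elliptic curve `Y ⊂ X`** — namely the radical curve of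
`γ = E ∈ NS(X)` (row A4-60: `E` degenerate iff `E ∧ E = 0`; its radical `Λ(L)⁰` is a complex lattice subspace of
rank `2`, Lange (1.22)), positively framed (`SubtorusFrame.ofSubspace`); with §2 the curve is unique, with §1 its
class is primitive, non-zero, of square zero: the correspondence of Theorem 1.1 up to the sign fixed there by
`(α · Θ) > 0`. [cite: Auffarth2015EllipticCurvesAbelianVarieties, §1 Thm. 1.1 and §2 Thm. 2.10] [cite: Kani1994EllipticCurvesAbelianSurfaces, (surfaces)] [cite: Lange2023AbelianVarietiesComplex, §1.5.4 (1.22), p. 58] -/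
theorem exists_cycleForm_of_primitive_of_wedge_self_eq_zero [FiniteDimensional ℂ E] (h2 : finrank ℂ E = 2)
    (e : Fin (2 + 2) ≃ ι) {γ : E [⋀^Fin 2]→L[ℝ] ℂ} (hγ : γ ∈ integralHodgeClasses Φ 1)
    (hprim : ∀ (k : ℤ) (β : E [⋀^Fin 2]→L[ℝ] ℂ), β ∈ integralForms Φ 2 → (k : ℂ) • β = γ → k = 1 ∨ k = -1)
    (hγγ : γ.wedge γ = 0) :
    ∃ (W : Submodule ℝ (ι → ℝ)) (hW : IsLatticeSubspace W) (hWc : IsComplexSubspace Φ W)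
      (eY : Fin 2 ≃ Fin (subRank W)) (hpos : orientationSign (subtorusPeriod Φ W hW hWc) eY = 1),
      W ≠ ⊥ ∧ W ≠ ⊤ ∧
        (γ = (SubtorusFrame.ofSubspace Φ W hW hWc eY hpos).cycleForm e ∨
          γ = -(SubtorusFrame.ofSubspace Φ W hW hWc eY hpos).cycleForm e) := by
  classical
  -- `γ = E ∈ NS(X)`, non-zero (primitive) and degenerate (`E ∧ E = 0`)
  obtain ⟨η, hηNS, rfl⟩ := (mem_integralHodgeClasses_one_iff_exists Φ).1 hγ
  have hη : IsNSForm Φ η := (mem_neronSeveriGroup_iff Φ).1 hηNS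
  have hne : η ≠ 0 := by
    intro h0
    have h := hprim 2 0 (zero_mem _) (by rw [h0]; ext v; simp)
    omega
  have hdeg : ∃ u : E, u ≠ 0 ∧ ∀ v : E, η ![u, v] = 0 := (degenerate_iff_wedge_self_eq_zero Φ h2 η).2 hγγ
  -- its radical `W = Λ(L)⁰`: a complex lattice subspace, `≠ 0` (degenerate), `≠ ⊤` (`E ≠ 0`), of rank `2`
  set W := nsRadical Φ η with hWdef
  have hW : IsLatticeSubspace W := hη.isLatticeSubspace_nsRadical
  have hWc : IsComplexSubspace Φ W := isComplexSubspace_nsRadical Φ hη.type_one_one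
  have hWb : W ≠ ⊥ := (nsRadical_ne_bot_iff Φ η).2 hdeg
  have hWt : W ≠ ⊤ := fun h ↦ hne ((nsRadical_eq_top_iff Φ η).1 h)
  have hcard : Fintype.card ι = 4 := by rw [← Fintype.card_congr e, Fintype.card_fin]
  have hsub2 : subRank W = 2 := by
    have hfr : finrank ℝ W = subRank W := finrank_eq_subRank hW
    have h0 : finrank ℝ W ≠ 0 := by
      rw [Ne, Submodule.finrank_eq_zero]; exact hWb
    have hlt : finrank ℝ W < 4 := by
      have h := Submodule.finrank_lt hWt
      rwa [finrank_fintype_fun_eq_card, hcard] at h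
    have hev := subRank_eq_two_mul_finrank Φ hW hWc
    omega
  -- a positively oriented enumeration of the adapted frame of `Λ ∩ W`
  obtain ⟨eY₀, hpos₀⟩ := exists_orientationSign_subtorusPeriod_eq_one Φ W hW hWc
  set eY : Fin 2 ≃ Fin (subRank W) := (finCongr hsub2.symm).trans eY₀ with heY
  have hpos : orientationSign (subtorusPeriod Φ W hW hWc) eY = 1 := by
    rw [heY]
    have h : (⇑((finCongr hsub2.symm).trans eY₀) : Fin 2 → Fin (subRank W)) = ⇑eY₀ ∘ Fin.cast hsub2.symm := rfl
    rw [h, orientationSign_comp_cast₄]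
    exact hpos₀
  refine ⟨W, hW, hWc, eY, hpos, hWb, hWt, ?_⟩
  -- `T_Y ⊆ rad E`, so `E = ±[Y]` by §3
  refine eq_or_eq_neg_cycleForm_of_primitive Φ W hW hWc eY hpos e (ofRealForm η)
    (ofRealForm_mem_integralForms_two Φ hη) hprim fun w hw v ↦ ?_
  rw [ofRealForm_apply, (mem_nsRadical_iff_forall Φ η).1 hw v, Complex.ofReal_zero]

/-- **Conversely (Theorem 1.1, the easy direction, with Lemma 2.7): the class `[Y]` of an elliptic curve on a complex
`2`-torus is a non-zero PRIMITIVE integral Hodge class with `[Y] ∧ [Y] = 0`.**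
[cite: Auffarth2015EllipticCurvesAbelianVarieties, §1 Thm. 1.1, §2 Prop. 2.1 and Lemma 2.7] [cite: Kani1994EllipticCurvesAbelianSurfaces, (surfaces)] -/
theorem cycleForm_ofSubspace_mem_and_primitive_and_wedge_self (W : Submodule ℝ (ι → ℝ)) (hW : IsLatticeSubspace W)
    (hWc : IsComplexSubspace Φ W) (eY : Fin (2 * 1) ≃ Fin (subRank W))
    (hpos : orientationSign (subtorusPeriod Φ W hW hWc) eY = 1) (e : Fin (2 * 1 + 2 * 1) ≃ ι) :
    (SubtorusFrame.ofSubspace Φ W hW hWc eY hpos).cycleForm e ∈ integralHodgeClasses Φ 1 ∧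
      (SubtorusFrame.ofSubspace Φ W hW hWc eY hpos).cycleForm e ≠ 0 ∧
      (∀ (k : ℤ) (β : E [⋀^Fin (2 * 1)]→L[ℝ] ℂ), β ∈ integralForms Φ (2 * 1) →
        (k : ℂ) • β = (SubtorusFrame.ofSubspace Φ W hW hWc eY hpos).cycleForm e → k = 1 ∨ k = -1) ∧
      ((SubtorusFrame.ofSubspace Φ W hW hWc eY hpos).cycleForm e).wedge
        ((SubtorusFrame.ofSubspace Φ W hW hWc eY hpos).cycleForm e) = 0 := by
  set Z := SubtorusFrame.ofSubspace Φ W hW hWc eY hpos with hZ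
  refine ⟨?_, cycleForm_ofSubspace_ne_zero Φ W hW hWc eY hpos e,
    fun k β hβ h ↦ cycleForm_ofSubspace_primitive Φ W hW hWc eY hpos e k hβ h, ?_⟩
  · exact (mem_integralHodgeClasses_iff Φ).2
      ⟨Z.cycleForm_mem_integralForms e, ((mem_hodgeClasses_iff Φ).1 (Z.cycleForm_mem_hodgeClasses e)).2⟩
  · exact SubtorusFrame.cycleForm_wedge_self_eq_zero Φ Z e (by norm_num)

end Surface

end ComplexTorus

end Literature.Geometry.Kaehler
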